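import Mathlib
import Literature.Analysis.FluidPDE.TaoCascadeDuhamel
import Literature.Analysis.FluidPDE.TaoAveragedCascade
import Literature.Analysis.FluidPDE.TaoAveragedCascadeHolds
import Summits.NavierStokesRegularity.NavierStokesRegularity.Theses.PerpetualPump

/-!
# Sketch — crux stmt-NavierStokesRegularity-1837 (PumpTransfer), ideator 1, round 1

First lemmas of the three idea cards (each a `def … : Prop` over existing declarations,
elaborating against the tree; `RhoSharpDissipation`, `ClockedFrontTypeI` and `FibreDecoherence`
are PROVED below — `rhoSharpDissipation_holds`, `clockedFrontTypeI_holds`,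
`fibreDecoherence_holds`, no sorry):

* card `rho-inclusion-one-exit-shooting`: `RhoSharpDissipation`, `FibreVarianceSlaving`
  (the ρ-decoupled form of Tao's Lemma 4.1 (iii)–(iv) over `modeDissX/modeDissE/modeScalarX/E`),
  `OneExitShooting` (discrete Ważewski with one exit coordinate, pure topology),
  `ClockedFrontTypeI` (box orbit ⇒ Type-I sup bound, elementary);
* card `spectral-law-continuation`: `FibreDecoherence` (fibres of one mode decohere by at most
  the relative rate spread, over `duhamelScalar`);
* card `coarse-lattice-certified-pump`: `LocalCascadeIsAveragedAt ε₀` (Thm 3.2 at a GIVEN ε₀)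
  and the bet `CoarseThm32`.
-/

namespace Summit.NavierStokesRegularity.NavierStokesRegularity.Cruxes.PumpTransfer.Sketch1

open MeasureTheory Set Filter
open Literature.Analysis.FluidPDE Literature.Analysis.FluidPDE.Tao2016

noncomputable section

/-! ## Card 1 — ρ-inclusion + one-exit shooting -/

/-- **ρ-sharp (4.10).** If the heat rate `4π²|ξ|²` is within `ρ'` of `L̄` on the frequency support of
the mode `(i,n)` (i.e. where `|ψ̂_{i,n}|² ≠ 0`), then the dissipation of the coefficient is `L̄·X̃`
up to `ρ'·(2Ẽ)^{1/2}` — Tao's `O((1+ε₀)^{2n}E^{1/2})` error with the factor `(1+ε₀)^{2n}` replaced by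
the SPREAD `ρ' = O(radius of Bᵢ)·(1+ε₀)^{2n}`, a free parameter of `CascadeWaveletData` independent of
`ε₀`. Proof: `|∫ φ (λ-L̄) ρ| ≤ ρ' ∫|φ|ρ ≤ ρ' (2Ẽ)^{1/2}` exactly as `abs_modeScalarX_le`. -/
def RhoSharpDissipation : Prop :=
  ∀ (ε₀ : ℝ) (m : ℕ) (𝒟 : CascadeWaveletData ε₀ m) (α : Fin m → Fin m → Fin m → ℤ × ℤ × ℤ → ℝ)
    (u : ℝ → L2C) (i₀ i : Fin m) (n₀ n : ℤ) (Lbar ρ' : ℝ), 0 < 1 + ε₀ → 0 ≤ ρ' →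
    Continuous (modeForcingRe 𝒟 α u i n) →
    (∀ᵐ ξ ∂(volume : Measure (EuclideanSpace ℝ (Fin 3))),
        modeWeight 𝒟 i n ξ ≠ 0 → |heatRate ξ - Lbar| ≤ ρ') →
    ∀ t : ℝ, |modeDissX 𝒟 α u i n i₀ n₀ t - Lbar * modeScalarX 𝒟 α u i n i₀ n₀ t|
      ≤ ρ' * Real.sqrt (2 * modeScalarE 𝒟 α u i n i₀ n₀ t)

/-- **Fibre-variance slaving.** With `D := Ẽ - ½X̃² = ½∫(φ-X̃)²ρ ≥ 0` (the energy defect IS the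
variance of the fibres `φ(ξ,·)` of the mode) one has `D' = -(B - X̃A)` (`hasDerivAt_modeScalarX/E`)
and `B - X̃A = ∫λ(φ-X̃)²ρ + X̃∫(λ-L̄)(φ-X̃)ρ ≥ L_min·2D - ρ'|X̃|(2D)^{1/2}`: the defect relaxes at
rate `2L_min` and is fed only at rate `ρ'|X̃|√(2D)`, so `√(2D) ≤ (ρ'/L_min)·sup|X̃|` — an `O(ρ)`
RELATIVE, uniform-in-time slaving replacing Tao's integrated (4.12). -/
def FibreVarianceSlaving : Prop :=
  ∀ (ε₀ : ℝ) (m : ℕ) (𝒟 : CascadeWaveletData ε₀ m) (α : Fin m → Fin m → Fin m → ℤ × ℤ × ℤ → ℝ)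
    (u : ℝ → L2C) (i₀ i : Fin m) (n₀ n : ℤ) (Lmin Lbar ρ' : ℝ), 0 < 1 + ε₀ → 0 ≤ ρ' →
    Continuous (modeForcingRe 𝒟 α u i n) →
    (∀ᵐ ξ ∂(volume : Measure (EuclideanSpace ℝ (Fin 3))),
        modeWeight 𝒟 i n ξ ≠ 0 → Lmin ≤ heatRate ξ ∧ |heatRate ξ - Lbar| ≤ ρ') →
    ∀ t : ℝ,
      Lmin * (2 * modeScalarE 𝒟 α u i n i₀ n₀ t - modeScalarX 𝒟 α u i n i₀ n₀ t ^ 2)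
          - ρ' * |modeScalarX 𝒟 α u i n i₀ n₀ t|
              * Real.sqrt (2 * modeScalarE 𝒟 α u i n i₀ n₀ t - modeScalarX 𝒟 α u i n i₀ n₀ t ^ 2)
        ≤ modeDissE 𝒟 α u i n i₀ n₀ t - modeScalarX 𝒟 α u i n i₀ n₀ t * modeDissX 𝒟 α u i n i₀ n₀ t

/-- **One-exit topological shooting** (discrete Ważewski principle with a single exit coordinate).
`N = [A₁,A₂] × K`, `F = (g,h)` continuous on `N` with `h(N) ⊆ K`, `g < A₁` on the whole left face
and `g > A₂` on the whole right face. Then on every continuous path of data inside `N` joining the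
two faces there is a datum whose FORWARD `F`-orbit never leaves `N`. (Proof: if not, `[0,1]` is the
disjoint union of "first exit to the left" and "first exit to the right", both open — connectedness.)
No compactness, convexity, degree or hyperbolicity is used; the hypotheses are `C⁰`-open in `F`. -/
def OneExitShooting : Prop :=
  ∀ (K : Type) [TopologicalSpace K] (A₁ A₂ : ℝ) (g : ℝ × K → ℝ) (h : ℝ × K → K),
    A₁ ≤ A₂ → ContinuousOn g (Set.Icc A₁ A₂ ×ˢ Set.univ) → ContinuousOn h (Set.Icc A₁ A₂ ×ˢ Set.univ) →
    (∀ y : K, g (A₁, y) < A₁) → (∀ y : K, A₂ < g (A₂, y)) →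
    ∀ γ : ℝ → ℝ × K, ContinuousOn γ (Set.Icc 0 1) →
      (∀ s ∈ Set.Icc (0 : ℝ) 1, (γ s).1 ∈ Set.Icc A₁ A₂) → (γ 0).1 = A₁ → (γ 1).1 = A₂ →
      ∃ s ∈ Set.Icc (0 : ℝ) 1, ∀ k : ℕ, ((fun p : ℝ × K => (g p, h p))^[k] (γ s)).1 ∈ Set.Icc A₁ A₂

/-- **Clocked front ⇒ Type-I rate** (the bookkeeping from "orbit confined in the box" to the crux's
`L^∞`-type weight). If the remaining time is at most `c₂` local clocks `lam^{-4n_f/5}` of the front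
scale `n_f(t)`, and the critical amplitudes `lam^{n/5}|X_{i,n}|` are bounded by `Δ` at and behind the
front and decay geometrically (`θ ≤ lam^{-2/5}`) ahead of it, then `lam^{3n/5}|X_{i,n}(t)| ≤ Δ√c₂/√(T-t)`
for all modes and all `t < T`. Two-line proof (geometric comparison), recorded as the target shape. -/
def ClockedFrontTypeI : Prop :=
  ∀ (lam : ℝ), 1 < lam → ∀ (m : ℕ) (X : Fin m → ℤ → ℝ → ℝ) (T Δ θ c₂ : ℝ) (nf : ℝ → ℤ),
    0 ≤ Δ → 0 < θ → θ * lam ^ (2 / 5 : ℝ) ≤ 1 → 0 < c₂ →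
    (∀ t, t < T → T - t ≤ c₂ * lam ^ (-(4 / 5 : ℝ) * (nf t))) →
    (∀ (i : Fin m) (n : ℤ) (t : ℝ), t < T →
        lam ^ ((1 / 5 : ℝ) * n) * |X i n t| ≤ Δ * θ ^ (Int.toNat (n - nf t))) →
    ∀ (i : Fin m) (n : ℤ) (t : ℝ), t < T →
      lam ^ ((3 / 5 : ℝ) * n) * |X i n t| ≤ Δ * Real.sqrt c₂ / Real.sqrt (T - t)


/-- **Proof of the first lemma (a)** `RhoSharpDissipation`: Cauchy–Schwarz against the mode's
probability density, as in `abs_modeDissX_le` but keeping the diagonal part `L̄·X̃` exact. -/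
theorem rhoSharpDissipation_holds : RhoSharpDissipation := by
  intro ε₀ m 𝒟 α u i₀ i n₀ n Lbar ρ' hε hρ0 hQ hρ t
  have hA : Integrable (fun ξ : EuclideanSpace ℝ (Fin 3) =>
      modeφ 𝒟 α u i n i₀ n₀ ξ t ^ 1 * (heatRate ξ * modeWeight 𝒟 i n ξ)) :=
    integrable_duhamelScalar_pow_mul (δ := modeDelta i₀ i n₀ n) hQ
      (integrable_heatRate_mul_modeWeight (𝒟 := 𝒟) (i := i) (n := n) hε)
      (heatRate_mul_modeWeight_eq_zero hε) 1 t
  have h1 : Integrable (fun ξ : EuclideanSpace ℝ (Fin 3) =>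
      modeφ 𝒟 α u i n i₀ n₀ ξ t ^ 1 * modeWeight 𝒟 i n ξ) :=
    integrable_duhamelScalar_pow_mul (δ := modeDelta i₀ i n₀ n) hQ integrable_modeWeight
      (modeWeight_eq_zero (𝒟 := 𝒟) (i := i) (n := n) hε) 1 t
  have hX : modeScalarX 𝒟 α u i n i₀ n₀ t =
      ∫ ξ, modeφ 𝒟 α u i n i₀ n₀ ξ t ^ 1 * modeWeight 𝒟 i n ξ := by
    simp only [modeScalarX, modeφ, pow_one]
  have hD : modeDissX 𝒟 α u i n i₀ n₀ t =
      ∫ ξ, modeφ 𝒟 α u i n i₀ n₀ ξ t ^ 1 * (heatRate ξ * modeWeight 𝒟 i n ξ) := rfl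
  have hdiff : modeDissX 𝒟 α u i n i₀ n₀ t - Lbar * modeScalarX 𝒟 α u i n i₀ n₀ t =
      ∫ ξ, (modeφ 𝒟 α u i n i₀ n₀ ξ t ^ 1 * (heatRate ξ * modeWeight 𝒟 i n ξ) -
        Lbar * (modeφ 𝒟 α u i n i₀ n₀ ξ t ^ 1 * modeWeight 𝒟 i n ξ)) := by
    rw [hD, hX, ← integral_const_mul, ← integral_sub hA (h1.const_mul Lbar)]
  rw [hdiff]
  have hsub := hA.sub (h1.const_mul Lbar)
  calc |∫ ξ, (modeφ 𝒟 α u i n i₀ n₀ ξ t ^ 1 * (heatRate ξ * modeWeight 𝒟 i n ξ) -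
          Lbar * (modeφ 𝒟 α u i n i₀ n₀ ξ t ^ 1 * modeWeight 𝒟 i n ξ))|
      ≤ ∫ ξ, |modeφ 𝒟 α u i n i₀ n₀ ξ t ^ 1 * (heatRate ξ * modeWeight 𝒟 i n ξ) -
          Lbar * (modeφ 𝒟 α u i n i₀ n₀ ξ t ^ 1 * modeWeight 𝒟 i n ξ)| := by
        rw [← Real.norm_eq_abs]
        refine (norm_integral_le_integral_norm _).trans (le_of_eq ?_)
        exact integral_congr_ae (Eventually.of_forall fun ξ => Real.norm_eq_abs _)
    _ ≤ ∫ ξ, ρ' * (|modeφ 𝒟 α u i n i₀ n₀ ξ t ^ 1| * modeWeight 𝒟 i n ξ) := by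
        refine integral_mono_ae hsub.abs ?_ ?_
        · refine (h1.abs.const_mul ρ').congr (Eventually.of_forall fun ξ => ?_)
          simp only [abs_mul, abs_of_nonneg (modeWeight_nonneg (𝒟 := 𝒟) (i := i) (n := n) ξ)]
        · filter_upwards [hρ] with ξ hξ
          have hw0 : 0 ≤ modeWeight 𝒟 i n ξ := modeWeight_nonneg ξ
          rw [show modeφ 𝒟 α u i n i₀ n₀ ξ t ^ 1 * (heatRate ξ * modeWeight 𝒟 i n ξ) -
              Lbar * (modeφ 𝒟 α u i n i₀ n₀ ξ t ^ 1 * modeWeight 𝒟 i n ξ) =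
              (heatRate ξ - Lbar) * (modeφ 𝒟 α u i n i₀ n₀ ξ t ^ 1 * modeWeight 𝒟 i n ξ) by ring]
          rw [abs_mul, abs_mul, abs_of_nonneg hw0]
          by_cases hw : modeWeight 𝒟 i n ξ = 0
          · simp [hw]
          · exact mul_le_mul_of_nonneg_right (hξ hw) (mul_nonneg (abs_nonneg _) hw0)
    _ = ρ' * ∫ ξ, |modeφ 𝒟 α u i n i₀ n₀ ξ t ^ 1| * modeWeight 𝒟 i n ξ := integral_const_mul _ _
    _ ≤ ρ' * Real.sqrt (2 * modeScalarE 𝒟 α u i n i₀ n₀ t) := by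
        refine mul_le_mul_of_nonneg_left ?_ hρ0
        have h := integral_abs_modeφ_mul_le (i₀ := i₀) (n₀ := n₀) (𝒟 := 𝒟) (α := α) (u := u)
          (i := i) (n := n) hε hQ t
        simpa only [pow_one] using h


/-- **Proof of the bookkeeping lemma** `ClockedFrontTypeI` (two geometric comparisons). -/
theorem clockedFrontTypeI_holds : ClockedFrontTypeI := by
  intro lam hlam m X T Δ θ c₂ nf hΔ hθ hθlam hc₂ hclock hprof i n t ht
  have hlam0 : 0 < lam := by linarith
  have hlam1 : (1 : ℝ) ≤ lam := hlam.le
  have hTt : 0 < T - t := by linarith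
  -- Step 1: the clock bound gives lam^{(2/5) n_f} ≤ √c₂ / √(T - t)
  have h45 : lam ^ ((4 / 5 : ℝ) * (nf t : ℝ)) * (T - t) ≤ c₂ := by
    have h := mul_le_mul_of_nonneg_left (hclock t ht) (Real.rpow_nonneg hlam0.le ((4 / 5 : ℝ) * (nf t : ℝ)))
    have hzero : (4 / 5 : ℝ) * (nf t : ℝ) + -(4 / 5 : ℝ) * (nf t : ℝ) = 0 := by ring
    calc lam ^ ((4 / 5 : ℝ) * (nf t : ℝ)) * (T - t)
        ≤ lam ^ ((4 / 5 : ℝ) * (nf t : ℝ)) * (c₂ * lam ^ (-(4 / 5 : ℝ) * (nf t : ℝ))) := h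
      _ = c₂ * (lam ^ ((4 / 5 : ℝ) * (nf t : ℝ)) * lam ^ (-(4 / 5 : ℝ) * (nf t : ℝ))) := by ring
      _ = c₂ := by rw [← Real.rpow_add hlam0, hzero, Real.rpow_zero, mul_one]
  have h25 : lam ^ ((2 / 5 : ℝ) * (nf t : ℝ)) ≤ Real.sqrt c₂ / Real.sqrt (T - t) := by
    have hsq : lam ^ ((2 / 5 : ℝ) * (nf t : ℝ)) = Real.sqrt (lam ^ ((4 / 5 : ℝ) * (nf t : ℝ))) := by
      rw [Real.sqrt_eq_rpow, ← Real.rpow_mul hlam0.le]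
      congr 1
      ring
    rw [hsq, ← Real.sqrt_div' c₂ hTt.le]
    exact Real.sqrt_le_sqrt ((le_div_iff₀ hTt).2 h45)
  -- Step 2: the profile bound gives lam^{(3/5) n} |X| ≤ Δ lam^{(2/5) n_f}
  have hmain : lam ^ ((3 / 5 : ℝ) * (n : ℝ)) * |X i n t| ≤ Δ * lam ^ ((2 / 5 : ℝ) * (nf t : ℝ)) := by
    have hp := hprof i n t ht
    have hsplit : lam ^ ((3 / 5 : ℝ) * (n : ℝ)) = lam ^ ((2 / 5 : ℝ) * (n : ℝ)) * lam ^ ((1 / 5 : ℝ) * (n : ℝ)) := by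
      rw [← Real.rpow_add hlam0]
      congr 1
      ring
    have hstep : lam ^ ((3 / 5 : ℝ) * (n : ℝ)) * |X i n t|
        ≤ lam ^ ((2 / 5 : ℝ) * (n : ℝ)) * (Δ * θ ^ Int.toNat (n - nf t)) := by
      rw [hsplit, mul_assoc]
      exact mul_le_mul_of_nonneg_left hp (Real.rpow_nonneg hlam0.le _)
    refine hstep.trans ?_
    rcases le_or_gt n (nf t) with hnk | hnk
    · have h0 : Int.toNat (n - nf t) = 0 := Int.toNat_eq_zero.mpr (by omega)
      rw [h0, pow_zero, mul_one, mul_comm]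
      refine mul_le_mul_of_nonneg_left ?_ hΔ
      refine Real.rpow_le_rpow_of_exponent_le hlam1 ?_
      have : (n : ℝ) ≤ (nf t : ℝ) := by exact_mod_cast hnk
      linarith
    · have h3 : (n : ℤ) = nf t + ((Int.toNat (n - nf t) : ℕ) : ℤ) := by omega
      have hnR : (n : ℝ) = (nf t : ℝ) + ((Int.toNat (n - nf t) : ℕ) : ℝ) := by exact_mod_cast h3
      have hsplit2 : lam ^ ((2 / 5 : ℝ) * (n : ℝ)) =
          lam ^ ((2 / 5 : ℝ) * (nf t : ℝ)) * (lam ^ (2 / 5 : ℝ)) ^ Int.toNat (n - nf t) := by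
        rw [hnR, mul_add, Real.rpow_add hlam0, ← Real.rpow_natCast, ← Real.rpow_mul hlam0.le]
      rw [hsplit2]
      have hθl : (lam ^ (2 / 5 : ℝ)) ^ Int.toNat (n - nf t) * θ ^ Int.toNat (n - nf t) ≤ 1 := by
        rw [← mul_pow]
        refine pow_le_one₀ (by positivity) ?_
        rw [mul_comm]
        exact hθlam
      calc lam ^ ((2 / 5 : ℝ) * (nf t : ℝ)) * (lam ^ (2 / 5 : ℝ)) ^ Int.toNat (n - nf t) * (Δ * θ ^ Int.toNat (n - nf t))
          = Δ * lam ^ ((2 / 5 : ℝ) * (nf t : ℝ)) *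
              ((lam ^ (2 / 5 : ℝ)) ^ Int.toNat (n - nf t) * θ ^ Int.toNat (n - nf t)) := by ring
        _ ≤ Δ * lam ^ ((2 / 5 : ℝ) * (nf t : ℝ)) * 1 :=
            mul_le_mul_of_nonneg_left hθl (by positivity)
        _ = Δ * lam ^ ((2 / 5 : ℝ) * (nf t : ℝ)) := mul_one _
  calc lam ^ ((3 / 5 : ℝ) * (n : ℝ)) * |X i n t| ≤ Δ * lam ^ ((2 / 5 : ℝ) * (nf t : ℝ)) := hmain
    _ ≤ Δ * (Real.sqrt c₂ / Real.sqrt (T - t)) := mul_le_mul_of_nonneg_left h25 hΔ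
    _ = Δ * Real.sqrt c₂ / Real.sqrt (T - t) := by ring

/-! ## Card 2 — continuation in the spectral law of the dissipation -/

/-- **Fibre decoherence.** Two fibres of one mode, with heat rates `L, L'`, the same datum `δ` and the
same forcing `Qr`, differ by at most the RELATIVE rate spread times the running sup:
`|φ_L(t) - φ_{L'}(t)| ≤ (|L-L'|/L)·sup_{[0,t]}|φ_{L'}|` (`w = φ_L-φ_{L'}` solves `w' = -Lw - (L-L')φ_{L'}`,
`w(0)=0`). This is the normal attraction of the diagonal `{φ(ξ,·) ≡ X̃}` that carries the ODE inside
the exact fibred (Volterra) system, with constant independent of `ε₀`. -/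
def FibreDecoherence : Prop :=
  ∀ (δ : ℝ) (Qr : ℝ → ℝ) (L L' t S : ℝ), Continuous Qr → 0 < L → 0 ≤ t →
    (∀ s ∈ Set.Icc 0 t, |duhamelScalar δ Qr L' s| ≤ S) →
    |duhamelScalar δ Qr L t - duhamelScalar δ Qr L' t| ≤ |L - L'| / L * S


/-- **Proof of the first lemma of card 2** `FibreDecoherence`: a two-sided fencing (barrier)
argument for `w = φ_L - φ_{L'}`, `w' = -L w - (L-L') φ_{L'}`, with the constant barriers
`±(|L-L'| S / L + ε)`. -/
theorem fibreDecoherence_holds : FibreDecoherence := by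
  intro δ Qr L L' t S hQ hL ht hS
  have hS0 : 0 ≤ S := (abs_nonneg _).trans (hS 0 ⟨le_rfl, ht⟩)
  have hM0 : 0 ≤ |L - L'| / L * S := by positivity
  -- derivative and continuity of the difference
  have hderiv : ∀ x, HasDerivAt (fun x => duhamelScalar δ Qr L x - duhamelScalar δ Qr L' x)
      ((-L * duhamelScalar δ Qr L x + Qr x) - (-L' * duhamelScalar δ Qr L' x + Qr x)) x :=
    fun x => (hasDerivAt_duhamelScalar hQ L x).sub (hasDerivAt_duhamelScalar hQ L' x)
  have hcont : Continuous (fun x => duhamelScalar δ Qr L x - duhamelScalar δ Qr L' x) :=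
    continuous_iff_continuousAt.2 fun x => (hderiv x).continuousAt
  -- two-sided algebraic control of the derivative in terms of the value `w`
  have hkey : ∀ x ∈ Set.Ico 0 t, ∀ w : ℝ, duhamelScalar δ Qr L x - duhamelScalar δ Qr L' x = w →
      -L * w - |L - L'| * S ≤ (-L * duhamelScalar δ Qr L x + Qr x) - (-L' * duhamelScalar δ Qr L' x + Qr x) ∧
      (-L * duhamelScalar δ Qr L x + Qr x) - (-L' * duhamelScalar δ Qr L' x + Qr x) ≤ -L * w + |L - L'| * S := by
    intro x hx w hw
    have hφ : |duhamelScalar δ Qr L' x| ≤ S := hS x ⟨hx.1, hx.2.le⟩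
    have hprod : |(L - L') * duhamelScalar δ Qr L' x| ≤ |L - L'| * S := by
      rw [abs_mul]
      exact mul_le_mul_of_nonneg_left hφ (abs_nonneg _)
    have hup := le_abs_self ((L - L') * duhamelScalar δ Qr L' x)
    have hlo := neg_abs_le ((L - L') * duhamelScalar δ Qr L' x)
    have hrw : (-L * duhamelScalar δ Qr L x + Qr x) - (-L' * duhamelScalar δ Qr L' x + Qr x)
        = -L * w - (L - L') * duhamelScalar δ Qr L' x := by rw [← hw]; ring
    rw [hrw]
    constructor <;> linarith
  -- upper fence for `w`
  have hupper : ∀ ε : ℝ, 0 < ε → ∀ x ∈ Set.Icc 0 t,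
      duhamelScalar δ Qr L x - duhamelScalar δ Qr L' x ≤ |L - L'| / L * S + ε := by
    intro ε hε x hx
    have hfence := image_le_of_deriv_right_lt_deriv_boundary
      (f := fun x => duhamelScalar δ Qr L x - duhamelScalar δ Qr L' x)
      (f' := fun x => (-L * duhamelScalar δ Qr L x + Qr x) - (-L' * duhamelScalar δ Qr L' x + Qr x))
      (a := 0) (b := t) (B := fun _ => |L - L'| / L * S + ε) (B' := fun _ => 0)
      hcont.continuousOn (fun x _ => (hderiv x).hasDerivWithinAt)
      (by simp only [duhamelScalar_zero, sub_self]; linarith)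
      (fun x => hasDerivAt_const x _)
      (by
        intro x hx hfx
        have h := (hkey x hx _ hfx).2
        have hLM : -L * (|L - L'| / L * S + ε) + |L - L'| * S = -L * ε := by
          field_simp
          ring
        show (-L * duhamelScalar δ Qr L x + Qr x) - (-L' * duhamelScalar δ Qr L' x + Qr x) < 0
        nlinarith [mul_pos hL hε])
    exact hfence hx
  -- upper fence for `-w`
  have hlower : ∀ ε : ℝ, 0 < ε → ∀ x ∈ Set.Icc 0 t,
      -(duhamelScalar δ Qr L x - duhamelScalar δ Qr L' x) ≤ |L - L'| / L * S + ε := by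
    intro ε hε x hx
    have hfence := image_le_of_deriv_right_lt_deriv_boundary
      (f := fun x => -(duhamelScalar δ Qr L x - duhamelScalar δ Qr L' x))
      (f' := fun x => -((-L * duhamelScalar δ Qr L x + Qr x) - (-L' * duhamelScalar δ Qr L' x + Qr x)))
      (a := 0) (b := t) (B := fun _ => |L - L'| / L * S + ε) (B' := fun _ => 0)
      hcont.neg.continuousOn (fun x _ => (hderiv x).neg.hasDerivWithinAt)
      (by simp only [duhamelScalar_zero, sub_self, neg_zero]; linarith)
      (fun x => hasDerivAt_const x _)
      (by
        intro x hx hfx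
        have hw : duhamelScalar δ Qr L x - duhamelScalar δ Qr L' x = -(|L - L'| / L * S + ε) := by
          have hfx' : -(duhamelScalar δ Qr L x - duhamelScalar δ Qr L' x) = |L - L'| / L * S + ε := hfx
          linarith
        have h := (hkey x hx _ hw).1
        have hLM : -L * (-(|L - L'| / L * S + ε)) - |L - L'| * S = L * ε := by
          field_simp
          ring
        show -((-L * duhamelScalar δ Qr L x + Qr x) - (-L' * duhamelScalar δ Qr L' x + Qr x)) < 0
        nlinarith [mul_pos hL hε])
    exact hfence hx
  have h1 : duhamelScalar δ Qr L t - duhamelScalar δ Qr L' t ≤ |L - L'| / L * S :=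
    le_of_forall_pos_le_add fun ε hε => hupper ε hε t ⟨ht, le_rfl⟩
  have h2 : -(duhamelScalar δ Qr L t - duhamelScalar δ Qr L' t) ≤ |L - L'| / L * S :=
    le_of_forall_pos_le_add fun ε hε => hlower ε hε t ⟨ht, le_rfl⟩
  exact abs_le.2 ⟨by linarith, h1⟩

/-! ## Card 3 — coarse lattice + certified box -/

/-- **Theorem 3.2 at a given dyadic parameter** (the tree's `localCascade_isAveraged` is
`∃ ε₁ > 0, ∀ ε₀ ≤ ε₁, LocalCascadeIsAveragedAt ε₀`; the card asks for an explicit, COARSE `ε₀`). -/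
def LocalCascadeIsAveragedAt (ε₀ : ℝ) : Prop :=
  ∀ T : L2C → L2C → L2C → ℂ, IsLocalCascadeForm ε₀ T →
    ∃ 𝒜 : AveragingDatum, ∀ u v w, MemH10df u → MemH10df v → MemH10dfC w → 𝒜.form u v w = T u v w

/-- The card's quantitative bet: local cascade operators with dyadic parameter `1/64` are averaged
Euler operators (to be settled by extracting the constant from the tree's proof of Thm 3.2). -/
def CoarseThm32 : Prop := LocalCascadeIsAveragedAt (1 / 64)

/-- Sanity: the tree's Theorem 3.2 gives `LocalCascadeIsAveragedAt ε₀` for all small `ε₀`. -/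
theorem localCascadeIsAveragedAt_of_small :
    ∃ ε₁ : ℝ, 0 < ε₁ ∧ ∀ ε₀ : ℝ, 0 < ε₀ → ε₀ ≤ ε₁ → LocalCascadeIsAveragedAt ε₀ := by
  obtain ⟨ε₁, hε₁, h⟩ := localCascade_isAveraged_holds
  exact ⟨ε₁, hε₁, fun ε₀ h0 h1 T hT => h ε₀ h0 h1 T hT⟩

/-! ## The crux, by name (what every line must conclude) -/

example : Summit.NavierStokesRegularity.NavierStokesRegularity.Theses.PerpetualPump.PumpTransfer =
    (Summit.NavierStokesRegularity.NavierStokesRegularity.Theses.PerpetualPump.CircuitPump →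
      Summit.NavierStokesRegularity.NavierStokesRegularity.Theses.PerpetualPump.AveragedTypeIBlowup) :=
  rfl

/-- Any proof of the conclusion closes the crux (the Transfer of cards 1 and 3). -/
theorem pumpTransfer_of_blowup
    (h : Summit.NavierStokesRegularity.NavierStokesRegularity.Theses.PerpetualPump.AveragedTypeIBlowup) :
    Summit.NavierStokesRegularity.NavierStokesRegularity.Theses.PerpetualPump.PumpTransfer :=
  fun _ => h

end

end Summit.NavierStokesRegularity.NavierStokesRegularity.Cruxes.PumpTransfer.Sketch1
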